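import Mathlib
import HarnessLib

/-!
# Item `LrcModEntire` (stmt-NavierStokesRegularity-20428) — (Q3) toolkit, part 2: CURVATURE OF A CRITICAL BRANCH (planar, class-free)

ns-k2-port-2 g5 (helper prover under the LEAD of item 20428, ns-poloidal-K2-p3 g14; `--supports stmt-NavierStokesRegularity-20428 --as helper`).
The bridge from «(F1) third-order bounds + uniform transversal non-degeneracy `θ_νν ≤ −κ₀`» to the curvature bound that the compactness of re-based branches
(`…LrcModEntireRidgeHullTools.exists_tendsto_rebased_curves`) consumes.  Setting: a `C³` function `w : ℝ × ℝ → ℝ` (the slice `σ·v₂(−1, P 0 ·)`), and a `C²`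
curve `γ : ℝ → ℝ × ℝ` of EUCLIDEAN unit speed lying in the critical set `{∇w = 0}` (a hot branch: `w = N`, `∇w = 0` on `H`); `ν = J γ′` its Euclidean unit normal.

* `fderiv_fderiv_apply_deriv_eq_zero` — differentiating `∇w ∘ γ ≡ 0`: the Hessian kills the tangent, `D²w(γ s)(γ′ s) = 0`;
* `hessian_eq_zero_of_two_branches` — NO VERTICES ON A NON-DEGENERATE RIDGE: two critical `C¹` curves through the same point with non-parallel tangents force
  `D²w = 0` there (so `D²w(ν,ν) ≤ −κ₀ < 0` along a hot web excludes crossings: in the (TH) column with ridge constant `κ > 0` the hot web is a disjoint union of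
  complete regular branches — the currency of `exists_tendsto_rebased_curves`);
* `deriv_deriv_eq_smul_normal` — Euclidean unit speed ⇒ `γ″ = c • ν` with `c = det(γ′, γ″)`;
* **`norm_deriv_deriv_le_of_critical_branch`** (+ `norm_iteratedDeriv_two_le_of_critical_branch`) — with the frozen directional derivative `φ = ∂_ν w`:
  `Dφ(γ′) ≡ 0` along the curve, and differentiating once more `D²φ(γ′,γ′) + Dφ(γ″) = 0`, i.e. `c·D²w(ν,ν) = −D²φ(γ′,γ′)`; hence with `D²w(γ s)(ν s, ν s) ≤ −κ₀ < 0` and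
  `‖D³w(γ s)‖ ≤ C₃`: **`‖γ″ s‖ ≤ C₃/κ₀`** (sup norm of `ℝ × ℝ`; also `iteratedDeriv 2 γ`), i.e. the curvature of a uniformly non-degenerate critical branch is bounded
  by the third jet.

WHAT THIS IS NOT: not a claim about Navier–Stokes regularity — planar calculus for the (Q3) hull step of the «ridge quasiconvexity» lever (memo `Cruxes/LrcModEntire/T2B-g14.md`
§9–§10; bears_on LADDER-NS N0, item 20428 / crux 19708; 20428/19708/27893 OPEN).  No summit statement is proved here.
-/

noncomputable section

-- the summit and its single sub-problem share the name (CONVENTIONS §1), as in every Theorems file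
set_option linter.dupNamespace false

namespace Summit.NavierStokesRegularity.NavierStokesRegularity.Theorems.PoloidalWindowDoorLrcModEntireRidgeBranchCurvature

open Set Filter Topology Function

variable {w : ℝ × ℝ → ℝ} {γ : ℝ → ℝ × ℝ}

/-- **The Hessian kills the tangent of a critical curve**: if `w` is `C²`, `γ` is differentiable and `∇w(γ s) = 0` for all `s`, then
`D²w(γ s)(γ′ s) = 0` (as a linear form). [folklore] -/
theorem fderiv_fderiv_apply_deriv_eq_zero {n : WithTop ℕ∞} (hw : ContDiff ℝ n w) (hn : 2 ≤ n) (hγ : Differentiable ℝ γ)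
    (hcrit : ∀ s, fderiv ℝ w (γ s) = 0) (s : ℝ) : fderiv ℝ (fderiv ℝ w) (γ s) (deriv γ s) = 0 := by
  have hD1 : Differentiable ℝ (fderiv ℝ w) := (hw.fderiv_right (m := 1) (le_trans (by norm_num) hn)).differentiable (by simp)
  have h1 : HasDerivAt (fun s => fderiv ℝ w (γ s)) (fderiv ℝ (fderiv ℝ w) (γ s) (deriv γ s)) s :=
    (hD1 (γ s)).hasFDerivAt.comp_hasDerivAt s (hγ s).hasDerivAt
  have h2 : HasDerivAt (fun s => fderiv ℝ w (γ s)) 0 s := by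
    have : (fun s => fderiv ℝ w (γ s)) = fun _ => (0 : ℝ × ℝ →L[ℝ] ℝ) := funext hcrit
    rw [this]
    exact hasDerivAt_const s 0
  exact h1.unique h2

/-- **No vertices on a non-degenerate ridge.**  If two differentiable curves `γ₁, γ₂` lie in the critical set of the `C²` function `w` and pass through the same point
`γ₁ s₁ = γ₂ s₂ = x` with NON-PARALLEL tangents (`det(γ₁′ s₁, γ₂′ s₂) ≠ 0`), then the Hessian of `w` vanishes at `x`: `D²w(x) u v = 0` for all `u, v`.  Hence a hot web
with `D²w(ν,ν) ≤ −κ₀ < 0` everywhere has no crossings. [folklore] -/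
theorem hessian_eq_zero_of_two_branches {n : WithTop ℕ∞} (hw : ContDiff ℝ n w) (hn : 2 ≤ n) {γ₁ γ₂ : ℝ → ℝ × ℝ} (hγ₁ : Differentiable ℝ γ₁) (hγ₂ : Differentiable ℝ γ₂)
    (hcrit₁ : ∀ s, fderiv ℝ w (γ₁ s) = 0) (hcrit₂ : ∀ s, fderiv ℝ w (γ₂ s) = 0) {s₁ s₂ : ℝ} {x : ℝ × ℝ} (hx₁ : γ₁ s₁ = x) (hx₂ : γ₂ s₂ = x)
    (hdet : (deriv γ₁ s₁).1 * (deriv γ₂ s₂).2 - (deriv γ₁ s₁).2 * (deriv γ₂ s₂).1 ≠ 0) (u v : ℝ × ℝ) :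
    fderiv ℝ (fderiv ℝ w) x u v = 0 := by
  set a := deriv γ₁ s₁ with ha
  set b := deriv γ₂ s₂ with hb
  have hA : fderiv ℝ (fderiv ℝ w) x a = 0 := by rw [← hx₁]; exact fderiv_fderiv_apply_deriv_eq_zero hw hn hγ₁ hcrit₁ s₁
  have hB : fderiv ℝ (fderiv ℝ w) x b = 0 := by rw [← hx₂]; exact fderiv_fderiv_apply_deriv_eq_zero hw hn hγ₂ hcrit₂ s₂
  -- `u` is a combination of `a` and `b`
  set d := a.1 * b.2 - a.2 * b.1 with hd
  have hu : u = ((u.1 * b.2 - u.2 * b.1) / d) • a + ((a.1 * u.2 - a.2 * u.1) / d) • b := by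
    ext <;> simp only [Prod.fst_add, Prod.snd_add, Prod.smul_fst, Prod.smul_snd, smul_eq_mul] <;> field_simp <;> ring
  rw [hu, map_add, map_smul, map_smul, hA, hB, smul_zero, smul_zero, add_zero]
  rfl

/-- **Euclidean unit speed ⇒ the acceleration is normal**: if `(γ′)₁² + (γ′)₂² ≡ 1` and `γ′` is differentiable, then `γ″ s = c • ν s` with `ν = (−(γ′)₂, (γ′)₁)` and
`c = (γ′ s).1 * (γ″ s).2 − (γ′ s).2 * (γ″ s).1`. [folklore] -/
theorem deriv_deriv_eq_smul_normal (hγ' : Differentiable ℝ (deriv γ)) (hunit : ∀ s, (deriv γ s).1 ^ 2 + (deriv γ s).2 ^ 2 = 1) (s : ℝ) :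
    deriv (deriv γ) s =
      ((deriv γ s).1 * (deriv (deriv γ) s).2 - (deriv γ s).2 * (deriv (deriv γ) s).1) • (-(deriv γ s).2, (deriv γ s).1) := by
  -- differentiate the unit-speed identity: `γ′ · γ″ = 0`
  have hd : HasDerivAt (deriv γ) (deriv (deriv γ) s) s := (hγ' s).hasDerivAt
  have h1 : HasDerivAt (fun s => (deriv γ s).1) (deriv (deriv γ) s).1 s :=
    ((ContinuousLinearMap.fst ℝ ℝ ℝ).hasFDerivAt).comp_hasDerivAt s hd
  have h2 : HasDerivAt (fun s => (deriv γ s).2) (deriv (deriv γ) s).2 s :=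
    ((ContinuousLinearMap.snd ℝ ℝ ℝ).hasFDerivAt).comp_hasDerivAt s hd
  have hsum : HasDerivAt (fun s => (deriv γ s).1 * (deriv γ s).1 + (deriv γ s).2 * (deriv γ s).2)
      ((deriv (deriv γ) s).1 * (deriv γ s).1 + (deriv γ s).1 * (deriv (deriv γ) s).1 +
        ((deriv (deriv γ) s).2 * (deriv γ s).2 + (deriv γ s).2 * (deriv (deriv γ) s).2)) s :=
    (h1.mul h1).add (h2.mul h2)
  have hconst : HasDerivAt (fun s => (deriv γ s).1 * (deriv γ s).1 + (deriv γ s).2 * (deriv γ s).2) 0 s := by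
    have : (fun s => (deriv γ s).1 * (deriv γ s).1 + (deriv γ s).2 * (deriv γ s).2) = fun _ => (1 : ℝ) :=
      funext fun s => by rw [← sq, ← sq]; exact hunit s
    rw [this]; exact hasDerivAt_const s 1
  have horth : (deriv γ s).1 * (deriv (deriv γ) s).1 + (deriv γ s).2 * (deriv (deriv γ) s).2 = 0 := by
    have := hsum.unique hconst
    linarith
  have hu := hunit s
  ext
  · simp only [Prod.smul_fst, smul_eq_mul]
    linear_combination (-(deriv (deriv γ) s).1) * hu + (deriv γ s).1 * horth
  · simp only [Prod.smul_snd, smul_eq_mul]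
    linear_combination (-(deriv (deriv γ) s).2) * hu + (deriv γ s).2 * horth

/-- In the sup norm of `ℝ × ℝ`, a Euclidean unit vector has norm `≤ 1`. [folklore] -/
theorem norm_le_one_of_sq_add_sq {p : ℝ × ℝ} (h : p.1 ^ 2 + p.2 ^ 2 = 1) : ‖p‖ ≤ 1 := by
  rw [norm_prod_le_iff]
  constructor
  · rw [Real.norm_eq_abs]; exact abs_le_one_iff_mul_self_le_one.2 (by nlinarith [sq_nonneg p.2])
  · rw [Real.norm_eq_abs]; exact abs_le_one_iff_mul_self_le_one.2 (by nlinarith [sq_nonneg p.1])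

/-- **CURVATURE OF A UNIFORMLY NON-DEGENERATE CRITICAL BRANCH.**  Let `w : ℝ × ℝ → ℝ` be `C³` with `‖D³w(γ s)‖ ≤ C₃` along a `C²` curve `γ` of Euclidean unit speed
lying in the critical set `{∇w = 0}`, and suppose the Hessian is uniformly negative on the Euclidean unit normal `ν = (−(γ′)₂, (γ′)₁)`:
`D²w(γ s) ![ν s, ν s] ≤ −κ₀ < 0`.  Then `‖γ″ s‖ ≤ C₃/κ₀` for every `s` (sup norm).  Proof, with `φ := ∂_ν w` (`ν = ν s` frozen): `Dφ(γ t)(γ′ t) = (φ ∘ γ)′(t) = 0`;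
differentiating again at `t = s`, `D²φ(γ′,γ′) + Dφ(γ″) = 0`; `γ″ = c•ν` (`deriv_deriv_eq_smul_normal`) and `Dφ(γ″) = c·D²w(ν,ν)`, so
`|c|·κ₀ ≤ |D²φ(γ′,γ′)| ≤ ‖D³w‖ ≤ C₃`. [folklore] -/
theorem norm_deriv_deriv_le_of_critical_branch {n : WithTop ℕ∞} (hw : ContDiff ℝ n w) (hn : 3 ≤ n) (hγ : ContDiff ℝ 2 γ)
    (hunit : ∀ s, (deriv γ s).1 ^ 2 + (deriv γ s).2 ^ 2 = 1) (hcrit : ∀ s, fderiv ℝ w (γ s) = 0)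
    {ν : ℝ → ℝ × ℝ} (hν : ∀ s, ν s = (-(deriv γ s).2, (deriv γ s).1)) {κ₀ C₃ : ℝ} (hκ₀ : 0 < κ₀)
    (hκ : ∀ s, iteratedFDeriv ℝ 2 w (γ s) ![ν s, ν s] ≤ -κ₀) (hC : ∀ s, ‖iteratedFDeriv ℝ 3 w (γ s)‖ ≤ C₃) (s : ℝ) :
    ‖deriv (deriv γ) s‖ ≤ C₃ / κ₀ := by
  -- differentiability bookkeeping
  have h2n : (2 : WithTop ℕ∞) ≤ n := le_trans (by norm_num) hn
  have hD1 : ContDiff ℝ 2 (fderiv ℝ w) := hw.fderiv_right (m := 2) (le_trans (by norm_num) hn)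
  have hγd : Differentiable ℝ γ := hγ.differentiable (by norm_num)
  have hγ'd : Differentiable ℝ (deriv γ) := hγ.differentiable_deriv_two
  have hγ' : HasDerivAt γ (deriv γ s) s := (hγd s).hasDerivAt
  have hγ'' : HasDerivAt (deriv γ) (deriv (deriv γ) s) s := (hγ'd s).hasDerivAt
  -- the frozen directional derivative `φ = ∂_u w`, `u = ν s`
  set u : ℝ × ℝ := ν s with hu
  set A : (ℝ × ℝ →L[ℝ] ℝ) →L[ℝ] ℝ := ContinuousLinearMap.apply ℝ ℝ u with hA
  set φ : ℝ × ℝ → ℝ := fun y => fderiv ℝ w y u with hφ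
  have hφA : φ = A ∘ fderiv ℝ w := by funext y; simp [hφ, hA]
  have hφc : ContDiff ℝ 2 φ := by rw [hφA]; exact A.contDiff.comp hD1
  have hφ1 : Differentiable ℝ φ := hφc.differentiable (by norm_num)
  have hφ2 : Differentiable ℝ (fderiv ℝ φ) := (hφc.fderiv_right (m := 1) (by norm_num)).differentiable (by simp)
  -- `Dφ(y)(v) = D²w(y)(v)(u)`
  have hDφ : ∀ y v, fderiv ℝ φ y v = fderiv ℝ (fderiv ℝ w) y v u := by
    intro y v
    have h : HasFDerivAt φ (A.comp (fderiv ℝ (fderiv ℝ w) y)) y := by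
      rw [hφA]; exact A.hasFDerivAt.comp y ((hD1.differentiable (by norm_num)) y).hasFDerivAt
    rw [h.fderiv]; simp [hA]
  -- (i) `Dφ(γ t)(γ′ t) = 0` for every `t`
  have hker : ∀ t, fderiv ℝ φ (γ t) (deriv γ t) = 0 := by
    intro t
    have h1 : HasDerivAt (fun t => φ (γ t)) (fderiv ℝ φ (γ t) (deriv γ t)) t :=
      (hφ1 (γ t)).hasFDerivAt.comp_hasDerivAt t (hγd t).hasDerivAt
    have h2 : HasDerivAt (fun t => φ (γ t)) 0 t := by
      have : (fun t => φ (γ t)) = fun _ => (0 : ℝ) := funext fun t => by simp [hφ, hcrit t]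
      rw [this]; exact hasDerivAt_const t 0
    exact h1.unique h2
  -- (ii) differentiate once more at `t = s`
  have hcomp := (hφ2 (γ s)).hasFDerivAt.comp_hasDerivAt s hγ'
  have hG1 : HasDerivAt (fun t => fderiv ℝ φ (γ t) (deriv γ t))
      (fderiv ℝ (fderiv ℝ φ) (γ s) (deriv γ s) (deriv γ s) + fderiv ℝ φ (γ s) (deriv (deriv γ) s)) s :=
    hcomp.clm_apply hγ''
  have hG0 : HasDerivAt (fun t => fderiv ℝ φ (γ t) (deriv γ t)) 0 s := by
    have : (fun t => fderiv ℝ φ (γ t) (deriv γ t)) = fun _ => (0 : ℝ) := funext hker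
    rw [this]; exact hasDerivAt_const s 0
  have hid : fderiv ℝ (fderiv ℝ φ) (γ s) (deriv γ s) (deriv γ s) + fderiv ℝ φ (γ s) (deriv (deriv γ) s) = 0 := hG1.unique hG0
  -- (iii) `γ″ = c • ν`, so `Dφ(γ″) = c·D²w(ν,ν)`
  set c : ℝ := (deriv γ s).1 * (deriv (deriv γ) s).2 - (deriv γ s).2 * (deriv (deriv γ) s).1 with hc
  have hacc : deriv (deriv γ) s = c • ν s := by rw [hν s, hc]; exact deriv_deriv_eq_smul_normal hγ'd hunit s
  have hkey : c * fderiv ℝ (fderiv ℝ w) (γ s) (ν s) (ν s) = -(fderiv ℝ (fderiv ℝ φ) (γ s) (deriv γ s) (deriv γ s)) := by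
    have h := hid
    rw [hDφ, hacc, map_smul, smul_apply, smul_eq_mul] at h
    linarith
  have hHess : fderiv ℝ (fderiv ℝ w) (γ s) (ν s) (ν s) ≤ -κ₀ := by
    have := hκ s
    rwa [iteratedFDeriv_two_apply] at this
  -- sup norms of the Euclidean unit vectors
  have hγ1 : ‖deriv γ s‖ ≤ 1 := norm_le_one_of_sq_add_sq (hunit s)
  have hν1 : ‖ν s‖ ≤ 1 := by
    refine norm_le_one_of_sq_add_sq (p := ν s) ?_
    rw [hν s]
    show (-(deriv γ s).2) ^ 2 + ((deriv γ s).1) ^ 2 = 1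
    rw [neg_sq]; linarith [hunit s]
  have hC0 : 0 ≤ C₃ := (norm_nonneg _).trans (hC s)
  -- (iv) the third-derivative bound `|D²φ(γ′,γ′)| ≤ C₃`
  have hAnorm : ‖A‖ ≤ 1 := by
    refine ContinuousLinearMap.opNorm_le_bound _ zero_le_one fun L => ?_
    rw [hA, ContinuousLinearMap.apply_apply, one_mul]
    exact (L.le_opNorm u).trans (mul_le_of_le_one_right (norm_nonneg _) hν1)
  have hD2φ : ‖iteratedFDeriv ℝ 2 φ (γ s)‖ ≤ C₃ := by
    have h1 : ‖iteratedFDeriv ℝ 2 φ (γ s)‖ ≤ ‖A‖ * ‖iteratedFDeriv ℝ 2 (fderiv ℝ w) (γ s)‖ := by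
      rw [hφA]; exact A.norm_iteratedFDeriv_comp_left (hD1.contDiffAt) le_rfl
    rw [norm_iteratedFDeriv_fderiv] at h1
    exact h1.trans ((mul_le_mul hAnorm (hC s) (norm_nonneg _) zero_le_one).trans_eq (one_mul _))
  have hD3 : |fderiv ℝ (fderiv ℝ φ) (γ s) (deriv γ s) (deriv γ s)| ≤ C₃ := by
    have e : fderiv ℝ (fderiv ℝ φ) (γ s) (deriv γ s) (deriv γ s) = iteratedFDeriv ℝ 2 φ (γ s) ![deriv γ s, deriv γ s] := by
      rw [iteratedFDeriv_two_apply]; rfl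
    rw [e, ← Real.norm_eq_abs]
    refine (ContinuousMultilinearMap.le_opNorm _ _).trans ?_
    have hprod : ∏ i : Fin 2, ‖(![deriv γ s, deriv γ s] : Fin 2 → ℝ × ℝ) i‖ ≤ 1 := by
      rw [Fin.prod_univ_two]
      simp only [Matrix.cons_val_zero, Matrix.cons_val_one]
      calc ‖deriv γ s‖ * ‖deriv γ s‖ ≤ 1 * 1 := by gcongr
        _ = 1 := by ring
    calc ‖iteratedFDeriv ℝ 2 φ (γ s)‖ * ∏ i : Fin 2, ‖(![deriv γ s, deriv γ s] : Fin 2 → ℝ × ℝ) i‖ ≤ C₃ * 1 :=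
          mul_le_mul hD2φ hprod (Finset.prod_nonneg fun i _ => norm_nonneg _) hC0
      _ = C₃ := mul_one _
  -- conclude `|c| ≤ C₃ / κ₀`
  have hcabs : |c| * κ₀ ≤ C₃ := by
    have h1 : |c| * κ₀ ≤ |c| * |fderiv ℝ (fderiv ℝ w) (γ s) (ν s) (ν s)| := by
      refine mul_le_mul_of_nonneg_left ?_ (abs_nonneg c)
      rw [abs_of_nonpos (by linarith)]; linarith
    have h2 : |c| * |fderiv ℝ (fderiv ℝ w) (γ s) (ν s) (ν s)| = |fderiv ℝ (fderiv ℝ φ) (γ s) (deriv γ s) (deriv γ s)| := by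
      rw [← abs_mul, hkey, abs_neg]
    linarith [h1, h2.le, hD3]
  have hcle : |c| ≤ C₃ / κ₀ := by rw [le_div_iff₀ hκ₀]; exact hcabs
  calc ‖deriv (deriv γ) s‖ = ‖c • ν s‖ := by rw [hacc]
    _ = |c| * ‖ν s‖ := by rw [norm_smul, Real.norm_eq_abs]
    _ ≤ C₃ / κ₀ * 1 := mul_le_mul hcle hν1 (norm_nonneg _) (div_nonneg hC0 hκ₀.le)
    _ = C₃ / κ₀ := mul_one _

/-- The same bound in `iteratedDeriv 2` currency (the hypothesis `hB` of `…LrcModEntireRidgeHullTools.exists_tendsto_rebased_curves`). [folklore] -/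
theorem norm_iteratedDeriv_two_le_of_critical_branch {n : WithTop ℕ∞} (hw : ContDiff ℝ n w) (hn : 3 ≤ n) (hγ : ContDiff ℝ 2 γ)
    (hunit : ∀ s, (deriv γ s).1 ^ 2 + (deriv γ s).2 ^ 2 = 1) (hcrit : ∀ s, fderiv ℝ w (γ s) = 0)
    {ν : ℝ → ℝ × ℝ} (hν : ∀ s, ν s = (-(deriv γ s).2, (deriv γ s).1)) {κ₀ C₃ : ℝ} (hκ₀ : 0 < κ₀)
    (hκ : ∀ s, iteratedFDeriv ℝ 2 w (γ s) ![ν s, ν s] ≤ -κ₀) (hC : ∀ s, ‖iteratedFDeriv ℝ 3 w (γ s)‖ ≤ C₃) (s : ℝ) :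
    ‖iteratedDeriv 2 γ s‖ ≤ C₃ / κ₀ := by
  rw [iteratedDeriv_succ, iteratedDeriv_one]
  exact norm_deriv_deriv_le_of_critical_branch hw hn hγ hunit hcrit hν hκ₀ hκ hC s

/-! ### The same in `ℝ³`-currency: a branch inside the horizontal plane `{y₂ = 0}` (the currency of the LEAD's `…LrcModEntireRidgeClass`)

Appended (ns-k2-port-2 g5): `γ : ℝ → EuclideanSpace ℝ (Fin 3)` with `γ s 2 = 0`, Euclidean unit speed `‖γ′ s‖ = 1`, in-plane unit normal
`ν s = (−(γ′ s)₁, (γ′ s)₀, 0)`, `f = σ·v₂(−1,·)` a `C³` function on `ℝ³` with `∇f = 0` along `γ`, Hessian `D²f(γ s)(ν s)(ν s) ≤ −κ₀` (the LEAD's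
`κ s = −D²f(γ s)(ν s)(ν s) ≥ κ₀`) and `‖D³f‖ ≤ C₃` ⇒ `‖γ″ s‖ ≤ C₃/κ₀`. -/

section Space

variable {f : EuclideanSpace ℝ (Fin 3) → ℝ} {γ₃ : ℝ → EuclideanSpace ℝ (Fin 3)}

/-- A coordinate of the derivative of a curve is the derivative of the coordinate. [folklore] -/
theorem hasDerivAt_apply_coord (hγ : Differentiable ℝ γ₃) (i : Fin 3) (s : ℝ) :
    HasDerivAt (fun s => γ₃ s i) (deriv γ₃ s i) s :=
  ((EuclideanSpace.proj (𝕜 := ℝ) i).hasFDerivAt).comp_hasDerivAt s (hγ s).hasDerivAt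

/-- A curve inside the plane `{y₂ = 0}` has horizontal velocity: `(γ′ s)₂ = 0`. [folklore] -/
theorem deriv_apply_two_eq_zero (hγ : Differentiable ℝ γ₃) (hplane : ∀ s, γ₃ s 2 = 0) (s : ℝ) : deriv γ₃ s 2 = 0 := by
  have h2 : HasDerivAt (fun s => γ₃ s 2) 0 s := by
    have : (fun s => γ₃ s 2) = fun _ => (0 : ℝ) := funext hplane
    rw [this]; exact hasDerivAt_const s 0
  exact (hasDerivAt_apply_coord hγ 2 s).unique h2

/-- In-plane Euclidean unit speed in coordinates: `(γ′)₀² + (γ′)₁² = 1`. [folklore] -/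
theorem sq_add_sq_eq_one_of_unit (hγ : Differentiable ℝ γ₃) (hplane : ∀ s, γ₃ s 2 = 0) (hunit : ∀ s, ‖deriv γ₃ s‖ = 1) (s : ℝ) :
    deriv γ₃ s 0 ^ 2 + deriv γ₃ s 1 ^ 2 = 1 := by
  have h := EuclideanSpace.real_norm_sq_eq (deriv γ₃ s)
  rw [hunit s, one_pow, Fin.sum_univ_three, deriv_apply_two_eq_zero hγ hplane s] at h
  linarith

/-- **Planar Euclidean unit speed ⇒ the acceleration is a multiple of the in-plane normal**: `γ″ = c • (−(γ′)₁, (γ′)₀, 0)` with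
`c = (γ′)₀(γ″)₁ − (γ′)₁(γ″)₀`. [folklore] -/
theorem deriv_deriv_eq_smul_planeNormal (hγ2 : ContDiff ℝ 2 γ₃) (hplane : ∀ s, γ₃ s 2 = 0) (hunit : ∀ s, ‖deriv γ₃ s‖ = 1) (s : ℝ) :
    deriv (deriv γ₃) s =
      (deriv γ₃ s 0 * deriv (deriv γ₃) s 1 - deriv γ₃ s 1 * deriv (deriv γ₃) s 0) • WithLp.toLp 2 ![-(deriv γ₃ s 1), deriv γ₃ s 0, 0] := by
  have hd : Differentiable ℝ γ₃ := hγ2.differentiable (by norm_num)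
  have hd' : Differentiable ℝ (deriv γ₃) := hγ2.differentiable_deriv_two
  have h2 : ∀ s, deriv γ₃ s 2 = 0 := deriv_apply_two_eq_zero hd hplane
  have h2' : deriv (deriv γ₃) s 2 = 0 := deriv_apply_two_eq_zero hd' h2 s
  have hsq : ∀ s, deriv γ₃ s 0 ^ 2 + deriv γ₃ s 1 ^ 2 = 1 := sq_add_sq_eq_one_of_unit hd hplane hunit
  -- differentiate the unit-speed identity: `γ′ · γ″ = 0`
  have hc0 := hasDerivAt_apply_coord hd' 0 s
  have hc1 := hasDerivAt_apply_coord hd' 1 s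
  have hsum : HasDerivAt (fun s => deriv γ₃ s 0 * deriv γ₃ s 0 + deriv γ₃ s 1 * deriv γ₃ s 1)
      (deriv (deriv γ₃) s 0 * deriv γ₃ s 0 + deriv γ₃ s 0 * deriv (deriv γ₃) s 0 +
        (deriv (deriv γ₃) s 1 * deriv γ₃ s 1 + deriv γ₃ s 1 * deriv (deriv γ₃) s 1)) s :=
    (hc0.mul hc0).add (hc1.mul hc1)
  have hconst : HasDerivAt (fun s => deriv γ₃ s 0 * deriv γ₃ s 0 + deriv γ₃ s 1 * deriv γ₃ s 1) 0 s := by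
    have : (fun s => deriv γ₃ s 0 * deriv γ₃ s 0 + deriv γ₃ s 1 * deriv γ₃ s 1) = fun _ => (1 : ℝ) :=
      funext fun s => by rw [← sq, ← sq]; exact hsq s
    rw [this]; exact hasDerivAt_const s 1
  have horth : deriv γ₃ s 0 * deriv (deriv γ₃) s 0 + deriv γ₃ s 1 * deriv (deriv γ₃) s 1 = 0 := by
    have := hsum.unique hconst
    linarith
  have hu := hsq s
  ext i
  fin_cases i
  · simp
    linear_combination (-(deriv (deriv γ₃) s 0)) * hu + (deriv γ₃ s 0) * horth
  · simp
    linear_combination (-(deriv (deriv γ₃) s 1)) * hu + (deriv γ₃ s 1) * horth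
  · simp [h2']

/-- The in-plane normal `(−(γ′)₁, (γ′)₀, 0)` of a planar unit-speed curve is a Euclidean unit vector. [folklore] -/
theorem norm_planeNormal_eq_one (hγ : Differentiable ℝ γ₃) (hplane : ∀ s, γ₃ s 2 = 0) (hunit : ∀ s, ‖deriv γ₃ s‖ = 1)
    {ν₃ : ℝ → EuclideanSpace ℝ (Fin 3)} (hν : ∀ s, ν₃ s = WithLp.toLp 2 ![-(deriv γ₃ s 1), deriv γ₃ s 0, 0]) (s : ℝ) : ‖ν₃ s‖ = 1 := by
  have hsq := sq_add_sq_eq_one_of_unit hγ hplane hunit s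
  have h : ‖ν₃ s‖ ^ 2 = 1 := by
    rw [EuclideanSpace.real_norm_sq_eq, Fin.sum_univ_three, hν s]
    simp
    linarith
  have h0 : 0 ≤ ‖ν₃ s‖ := norm_nonneg _
  nlinarith

/-- **CURVATURE OF A UNIFORMLY NON-DEGENERATE CRITICAL BRANCH, `ℝ³`-planar currency.**  `f : ℝ³ → ℝ` of class `C³` with `‖D³f(γ s)‖ ≤ C₃`; `γ` a `C²` curve in
the plane `{y₂ = 0}` of Euclidean unit speed inside the critical set `{∇f = 0}`; in-plane unit normal `ν s = (−(γ′ s)₁, (γ′ s)₀, 0)`; Hessian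
`D²f(γ s)(ν s)(ν s) ≤ −κ₀ < 0` (i.e. the LEAD's `κ s = −D²f(γ s)(ν s)(ν s) ≥ κ₀`).  Then `‖γ″ s‖ ≤ C₃/κ₀`.  Same proof as the `ℝ × ℝ` version (frozen
directional derivative `φ = ∂_ν f`). [folklore] -/
theorem norm_deriv_deriv_le_of_critical_planeBranch {n : WithTop ℕ∞} (hf : ContDiff ℝ n f) (hn : 3 ≤ n) (hγ2 : ContDiff ℝ 2 γ₃)
    (hplane : ∀ s, γ₃ s 2 = 0) (hunit : ∀ s, ‖deriv γ₃ s‖ = 1) (hcrit : ∀ s, fderiv ℝ f (γ₃ s) = 0)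
    {ν₃ : ℝ → EuclideanSpace ℝ (Fin 3)} (hν : ∀ s, ν₃ s = WithLp.toLp 2 ![-(deriv γ₃ s 1), deriv γ₃ s 0, 0])
    {κ₀ C₃ : ℝ} (hκ₀ : 0 < κ₀) (hκ : ∀ s, fderiv ℝ (fderiv ℝ f) (γ₃ s) (ν₃ s) (ν₃ s) ≤ -κ₀)
    (hC : ∀ s, ‖iteratedFDeriv ℝ 3 f (γ₃ s)‖ ≤ C₃) (s : ℝ) :
    ‖deriv (deriv γ₃) s‖ ≤ C₃ / κ₀ := by
  -- differentiability bookkeeping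
  have h2n : (2 : WithTop ℕ∞) ≤ n := le_trans (by norm_num) hn
  have hD1 : ContDiff ℝ 2 (fderiv ℝ f) := hf.fderiv_right (m := 2) (le_trans (by norm_num) hn)
  have hγd : Differentiable ℝ γ₃ := hγ2.differentiable (by norm_num)
  have hγ'd : Differentiable ℝ (deriv γ₃) := hγ2.differentiable_deriv_two
  have hγ' : HasDerivAt γ₃ (deriv γ₃ s) s := (hγd s).hasDerivAt
  have hγ'' : HasDerivAt (deriv γ₃) (deriv (deriv γ₃) s) s := (hγ'd s).hasDerivAt
  -- the frozen directional derivative `φ = ∂_u f`, `u = ν₃ s`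
  set u : EuclideanSpace ℝ (Fin 3) := ν₃ s with hu
  set A : (EuclideanSpace ℝ (Fin 3) →L[ℝ] ℝ) →L[ℝ] ℝ := ContinuousLinearMap.apply ℝ ℝ u with hA
  set φ : EuclideanSpace ℝ (Fin 3) → ℝ := fun y => fderiv ℝ f y u with hφ
  have hφA : φ = A ∘ fderiv ℝ f := by funext y; simp [hφ, hA]
  have hφc : ContDiff ℝ 2 φ := by rw [hφA]; exact A.contDiff.comp hD1
  have hφ1 : Differentiable ℝ φ := hφc.differentiable (by norm_num)
  have hφ2 : Differentiable ℝ (fderiv ℝ φ) := (hφc.fderiv_right (m := 1) (by norm_num)).differentiable (by simp)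
  have hDφ : ∀ y w, fderiv ℝ φ y w = fderiv ℝ (fderiv ℝ f) y w u := by
    intro y w
    have h : HasFDerivAt φ (A.comp (fderiv ℝ (fderiv ℝ f) y)) y := by
      rw [hφA]; exact A.hasFDerivAt.comp y ((hD1.differentiable (by norm_num)) y).hasFDerivAt
    rw [h.fderiv]; simp [hA]
  -- (i) `Dφ(γ t)(γ′ t) = 0` for every `t`
  have hker : ∀ t, fderiv ℝ φ (γ₃ t) (deriv γ₃ t) = 0 := by
    intro t
    have h1 : HasDerivAt (fun t => φ (γ₃ t)) (fderiv ℝ φ (γ₃ t) (deriv γ₃ t)) t :=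
      (hφ1 (γ₃ t)).hasFDerivAt.comp_hasDerivAt t (hγd t).hasDerivAt
    have h2 : HasDerivAt (fun t => φ (γ₃ t)) 0 t := by
      have : (fun t => φ (γ₃ t)) = fun _ => (0 : ℝ) := funext fun t => by simp [hφ, hcrit t]
      rw [this]; exact hasDerivAt_const t 0
    exact h1.unique h2
  -- (ii) differentiate once more at `t = s`
  have hcomp := (hφ2 (γ₃ s)).hasFDerivAt.comp_hasDerivAt s hγ'
  have hG1 : HasDerivAt (fun t => fderiv ℝ φ (γ₃ t) (deriv γ₃ t))
      (fderiv ℝ (fderiv ℝ φ) (γ₃ s) (deriv γ₃ s) (deriv γ₃ s) + fderiv ℝ φ (γ₃ s) (deriv (deriv γ₃) s)) s :=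
    hcomp.clm_apply hγ''
  have hG0 : HasDerivAt (fun t => fderiv ℝ φ (γ₃ t) (deriv γ₃ t)) 0 s := by
    have : (fun t => fderiv ℝ φ (γ₃ t) (deriv γ₃ t)) = fun _ => (0 : ℝ) := funext hker
    rw [this]; exact hasDerivAt_const s 0
  have hid : fderiv ℝ (fderiv ℝ φ) (γ₃ s) (deriv γ₃ s) (deriv γ₃ s) + fderiv ℝ φ (γ₃ s) (deriv (deriv γ₃) s) = 0 := hG1.unique hG0
  -- (iii) `γ″ = c • ν`
  set c : ℝ := deriv γ₃ s 0 * deriv (deriv γ₃) s 1 - deriv γ₃ s 1 * deriv (deriv γ₃) s 0 with hc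
  have hacc : deriv (deriv γ₃) s = c • ν₃ s := by rw [hν s, hc]; exact deriv_deriv_eq_smul_planeNormal hγ2 hplane hunit s
  have hkey : c * fderiv ℝ (fderiv ℝ f) (γ₃ s) (ν₃ s) (ν₃ s) = -(fderiv ℝ (fderiv ℝ φ) (γ₃ s) (deriv γ₃ s) (deriv γ₃ s)) := by
    have h := hid
    rw [hDφ, hacc, map_smul, smul_apply, smul_eq_mul] at h
    linarith
  -- unit vectors and the third-derivative bound
  have hγ1 : ‖deriv γ₃ s‖ ≤ 1 := (hunit s).le
  have hν1 : ‖ν₃ s‖ ≤ 1 := (norm_planeNormal_eq_one hγd hplane hunit hν s).le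
  have hC0 : 0 ≤ C₃ := (norm_nonneg _).trans (hC s)
  have hAnorm : ‖A‖ ≤ 1 := by
    refine ContinuousLinearMap.opNorm_le_bound _ zero_le_one fun L => ?_
    rw [hA, ContinuousLinearMap.apply_apply, one_mul]
    exact (L.le_opNorm u).trans (mul_le_of_le_one_right (norm_nonneg _) hν1)
  have hD2φ : ‖iteratedFDeriv ℝ 2 φ (γ₃ s)‖ ≤ C₃ := by
    have h1 : ‖iteratedFDeriv ℝ 2 φ (γ₃ s)‖ ≤ ‖A‖ * ‖iteratedFDeriv ℝ 2 (fderiv ℝ f) (γ₃ s)‖ := by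
      rw [hφA]; exact A.norm_iteratedFDeriv_comp_left (hD1.contDiffAt) le_rfl
    rw [norm_iteratedFDeriv_fderiv] at h1
    exact h1.trans ((mul_le_mul hAnorm (hC s) (norm_nonneg _) zero_le_one).trans_eq (one_mul _))
  have hD3 : |fderiv ℝ (fderiv ℝ φ) (γ₃ s) (deriv γ₃ s) (deriv γ₃ s)| ≤ C₃ := by
    have e : fderiv ℝ (fderiv ℝ φ) (γ₃ s) (deriv γ₃ s) (deriv γ₃ s) = iteratedFDeriv ℝ 2 φ (γ₃ s) ![deriv γ₃ s, deriv γ₃ s] := by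
      rw [iteratedFDeriv_two_apply]; rfl
    rw [e, ← Real.norm_eq_abs]
    refine (ContinuousMultilinearMap.le_opNorm _ _).trans ?_
    have hprod : ∏ i : Fin 2, ‖(![deriv γ₃ s, deriv γ₃ s] : Fin 2 → EuclideanSpace ℝ (Fin 3)) i‖ ≤ 1 := by
      rw [Fin.prod_univ_two]
      simp only [Matrix.cons_val_zero, Matrix.cons_val_one]
      calc ‖deriv γ₃ s‖ * ‖deriv γ₃ s‖ ≤ 1 * 1 := by gcongr
        _ = 1 := by ring
    calc ‖iteratedFDeriv ℝ 2 φ (γ₃ s)‖ * ∏ i : Fin 2, ‖(![deriv γ₃ s, deriv γ₃ s] : Fin 2 → EuclideanSpace ℝ (Fin 3)) i‖ ≤ C₃ * 1 :=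
          mul_le_mul hD2φ hprod (Finset.prod_nonneg fun i _ => norm_nonneg _) hC0
      _ = C₃ := mul_one _
  -- conclude
  have hcabs : |c| * κ₀ ≤ C₃ := by
    have h1 : |c| * κ₀ ≤ |c| * |fderiv ℝ (fderiv ℝ f) (γ₃ s) (ν₃ s) (ν₃ s)| := by
      refine mul_le_mul_of_nonneg_left ?_ (abs_nonneg c)
      rw [abs_of_nonpos (by linarith [hκ s])]; linarith [hκ s]
    have h2 : |c| * |fderiv ℝ (fderiv ℝ f) (γ₃ s) (ν₃ s) (ν₃ s)| = |fderiv ℝ (fderiv ℝ φ) (γ₃ s) (deriv γ₃ s) (deriv γ₃ s)| := by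
      rw [← abs_mul, hkey, abs_neg]
    linarith [h1, h2.le, hD3]
  have hcle : |c| ≤ C₃ / κ₀ := by rw [le_div_iff₀ hκ₀]; exact hcabs
  calc ‖deriv (deriv γ₃) s‖ = ‖c • ν₃ s‖ := by rw [hacc]
    _ = |c| * ‖ν₃ s‖ := by rw [norm_smul, Real.norm_eq_abs]
    _ ≤ C₃ / κ₀ * 1 := mul_le_mul hcle hν1 (norm_nonneg _) (div_nonneg hC0 hκ₀.le)
    _ = C₃ / κ₀ := mul_one _

/-- The same bound in `iteratedDeriv 2` currency (`hB` of `…LrcModEntireRidgeHullTools.exists_tendsto_rebased_curves` with `V = ℝ³`). [folklore] -/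
theorem norm_iteratedDeriv_two_le_of_critical_planeBranch {n : WithTop ℕ∞} (hf : ContDiff ℝ n f) (hn : 3 ≤ n) (hγ2 : ContDiff ℝ 2 γ₃)
    (hplane : ∀ s, γ₃ s 2 = 0) (hunit : ∀ s, ‖deriv γ₃ s‖ = 1) (hcrit : ∀ s, fderiv ℝ f (γ₃ s) = 0)
    {ν₃ : ℝ → EuclideanSpace ℝ (Fin 3)} (hν : ∀ s, ν₃ s = WithLp.toLp 2 ![-(deriv γ₃ s 1), deriv γ₃ s 0, 0])
    {κ₀ C₃ : ℝ} (hκ₀ : 0 < κ₀) (hκ : ∀ s, fderiv ℝ (fderiv ℝ f) (γ₃ s) (ν₃ s) (ν₃ s) ≤ -κ₀)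
    (hC : ∀ s, ‖iteratedFDeriv ℝ 3 f (γ₃ s)‖ ≤ C₃) (s : ℝ) :
    ‖iteratedDeriv 2 γ₃ s‖ ≤ C₃ / κ₀ := by
  rw [iteratedDeriv_succ, iteratedDeriv_one]
  exact norm_deriv_deriv_le_of_critical_planeBranch hf hn hγ2 hplane hunit hcrit hν hκ₀ hκ hC s

end Space

end Summit.NavierStokesRegularity.NavierStokesRegularity.Theorems.PoloidalWindowDoorLrcModEntireRidgeBranchCurvature

end
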